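import Summits.QuantumFields.YangMills.Theorems.AlphaInputsT3ACv3StartKnit
import Summits.QuantumFields.YangMills.Theorems.AlphaInputsT3ACv3BallSystem
import Summits.QuantumFields.YangMills.Theorems.AlphaInputsT3ACv3PerturbedPlaquette
import Literature.MathematicalPhysics.QuantumFieldTheory.Balaban1983to89.T3ContinuumYM3Torus
import HarnessLib

/-!
# `AlphaInputsT3ACv3StartT3` — START v3.1 for the (FL) `hLift` binder, row (S5), part 4 at `P := F.P K` (d = 3 by `rfl`): **THE CANONICAL START FIELD ON THE THREE-TORUS** —
# `startT3 F K k Ω V b := startSys k Ω V (MballT3 …)` with the ball model fields `MballT3 v := ballModel R b (pullB v tubeSecΩ)` of `…v3BallSystem`; ★★★ `dist1_plaqHol_startT3_le`: from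
# `dist1 V(∂Q) ≤ ε′` on `plaqsIn k Ω` (so `‖F′_Q‖ ≤ 2ε′`), the SHELL bound `b` on the boundary plaquettes of the vertex cubes of stage (T), the (S3)∕log smallness rows in `(R, b)`, and
# the three lattice binders of (S5)-4b, every `q ∈ plaqsIn 0 Ω` has `dist1 (startT3(∂q)) ≤ max (exp((2r+1)⁻²·2ε′) − 1) (81601·b)` — lane `pub-balaban3d` ∕ cell `ym3-torus`, seat
# `ym-ust-19936-w1` (g2, LEAD)

WHY (bus PROGRESS 5 04:12Z; OWNER RULING FL-SMALL (c′) 03:29Z-label: smallness rows stay DISPLAYED binders `(hε-type)`, discharged at the `∃ B₀ … ∃ 𝔠` construction point of p590363 by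
(FL-θ)).  THIS FILE plugs the d = 3 seam into the generic knit: (hM)∕(hP) of `dist1_plaqHol_startSys_le` ⇐ `ballModel_eq_of_bdryBond` ∕ `dist1_plaqB_ballModel_le'` ⇐ the shell bound;
`‖F′_Q‖ ≤ 2ε′` ⇐ `norm_FpOf_le` + `wordQ_eq_inv` + `dist1_inv`.  LEFT DISPLAYED (by name, for ★w2 g2 ∕ 19936-w8 and the M22 knit): (hbox)∕(hsep)∕(hcov) of (S5)-4b; the shell
bound `hshell` (= `dist1_plaqHol_tubeSec_le` at the shell predicate, same lattice facts); the torus-size rows; the five smallness rows in `(R, b)`.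
WHAT IS HERE: `MballT3`, `startT3` (defs); `MballT3_eq_of_bdryBond` (hM), `dist1_plaqB_MballT3_le` (hP), `norm_FpOf_le_of_dist1` (`‖F′_Q‖ ≤ 2ε′`), ★★★`dist1_plaqHol_startT3_le`,
`startT3_apply_of_quiet`.
HONEST FRAMING.  Bookkeeping; lattice binders and smallness rows displayed, not proved; (FL)∕`hLift` NOT proved; count-neutral helper toward R3 2′ (items 19936∕19935); registry
untouched; nothing about d = 4, the continuum, or a mass gap; YM₃ on T³ is rung R3, not Clay.

References: T. Bałaban, Commun. Math. Phys. 102 (1985) 277–309 [Balaban1985Variational] ((8), (11)–(15) pp.279–280); Commun. Math. Phys. 98 (1985) 17–51 [Balaban1985Averaging]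
((8)–(9), (12) p.19, (19)–(23) p.21).
-/

set_option autoImplicit false

noncomputable section

open scoped Matrix.Norms.L2Operator

namespace Summit.QuantumFields.YangMills.Theorems.TubeStart

open Literature.MathematicalPhysics.QuantumFieldTheory.Balaban1983to89
open Literature.MathematicalPhysics.QuantumFieldTheory.Balaban1983to89.T4AdjointCovarianceUnitary (lieSU expSU)
open Literature.MathematicalPhysics.QuantumFieldTheory.Balaban1983to89.BlockAveragingSectionAction (iterSec)
open Literature.MathematicalPhysics.QuantumFieldTheory.Balaban1983to89.B10Eq38TorusDomains (toFine plaqsIn)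
open Literature.MathematicalPhysics.QuantumFieldTheory.Balaban1983to89.T3ContinuumYM3Torus (T3Family)
open Summit.QuantumFields.Balaban3D.Carriers
open Summit.QuantumFields.YangMills.Theorems.ModelBox
open Summit.QuantumFields.YangMills.Theorems.PerturbedPlaquette (dist1_SU_eq)

variable (F : T3Family) (K : ℕ) {n : Type*} [Fintype n] [DecidableEq n] [Nonempty n] (k : ℕ) (Ω : Set (Site (F.P K) 0))
  (V : GaugeField (F.P K) k (Matrix.specialUnitaryGroup n ℂ)) (b : ℝ)

/-- **THE BALL MODEL FIELDS ON THE THREE-TORUS**: at the vertex site `v`, `ballModel R b` of stage (T) read through the chart (`(F.P K).d = 3` by `rfl`). [cite: Balaban1985Variational, (8)+(11) p.279] -/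
def MballT3 (v : Site (F.P K) 0) : (Fin (F.P K).d → ℤ) → Fin (F.P K).d → Matrix.specialUnitaryGroup n ℂ :=
  ballModel (RbT (F.P K) k) b (pullB v (tubeSecΩ k Ω V))

/-- **★ THE CANONICAL START FIELD ON THE THREE-TORUS.** [cite: Balaban1985Variational, (11) p.279] -/
def startT3 : GaugeField (F.P K) 0 (Matrix.specialUnitaryGroup n ℂ) := startSys k Ω V (MballT3 F K k Ω V b)

section Rows

variable {F K k Ω V b}
variable (hR : 1 ≤ RbT (F.P K) k) (hb : 0 ≤ b) (hsmall : 320 * (RbT (F.P K) k : ℝ) ^ 2 * b ≤ 1) (h4800 : 4800 * (RbT (F.P K) k : ℝ) * b ≤ 1)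
  (hπ : (Fintype.card n : ℝ) * (200 * (RbT (F.P K) k) * b) < Real.pi) (hπ' : (Fintype.card n : ℝ) * (20 * (RbT (F.P K) k : ℝ) ^ 2 * b) < Real.pi)
  (hshell : ∀ v, IsBallΩ k Ω v → ∀ (u : Fin (F.P K).d → ℤ) (μ ν : Fin (F.P K).d), BdryPlaq (RbT (F.P K) k) u μ ν →
    GaugeGroup.dist1 (plaqB (pullB v (tubeSecΩ k Ω V)) u μ ν) ≤ b)
include hR hb hsmall h4800 hπ hπ' hshell

/-- **(hM) ON THE THREE-TORUS**: on the tangential boundary bonds of an interior-vertex cube the ball model field is stage (T). [cite: Balaban1985Variational, (11)–(13) pp.279–280] -/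
theorem MballT3_eq_of_bdryBond : ∀ v, IsBallΩ k Ω v → ∀ (u : Fin (F.P K).d → ℤ) (κ : Fin (F.P K).d), BdryBond (RbT (F.P K) k) u κ →
    MballT3 F K k Ω V b v u κ = pullB v (tubeSecΩ k Ω V) u κ := by
  intro v hv u κ hbd
  unfold MballT3
  exact ballModel_eq_of_bdryBond hR _ hb hsmall h4800 hπ (hshell v hv) hπ' hbd

/-- **(hP) ON THE THREE-TORUS**: every box plaquette of the ball model field is `81601·b`-flat. [cite: Balaban1985Variational, (8)+(11)–(14) pp.279–280] -/
theorem dist1_plaqB_MballT3_le : ∀ v, IsBallΩ k Ω v → ∀ (u : Fin (F.P K).d → ℤ) (μ ν : Fin (F.P K).d), μ < ν → PlaqInBox (RbT (F.P K) k) u μ ν →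
    GaugeGroup.dist1 (plaqB (MballT3 F K k Ω V b v) u μ ν) ≤ 81601 * b := by
  intro v hv u μ ν hμν hu
  unfold MballT3
  exact dist1_plaqB_ballModel_le' hR _ hb hsmall h4800 hπ (hshell v hv) hπ' (ne_of_lt hμν) hu

end Rows

/-- **`‖F′_Q‖ ≤ 2ε′` FROM `dist1 V(∂Q) ≤ ε′`** (`‖F′_Q‖ ≤ 2‖(V(∂Q))⁻¹ − 1‖ = 2·dist1 V(∂Q)`). [cite: Balaban1985Variational, (15) p.280] -/
theorem norm_FpOf_le_of_dist1 {ε' : ℝ} (hV : ∀ Q, Q ∈ plaqsIn k Ω → GaugeGroup.dist1 (GaugeField.plaqHol V Q) ≤ ε') :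
    ∀ Q, IsTubeΩ k Ω Q → ‖((FpOf k V Q : lieSU n) : Matrix n n ℂ)‖ ≤ 2 * ε' := by
  intro Q hQ
  refine (norm_FpOf_le k V Q).trans ?_
  rw [← dist1_SU_eq, wordQ_eq_inv, GaugeGroup.dist1_inv]
  exact mul_le_mul_of_nonneg_left (hV Q hQ) (by norm_num)

open Classical in
/-- **★★★ THE CANONICAL START FIELD ON THE THREE-TORUS IS FLAT ON EVERY CONSTRAINED PLAQUETTE**: for `q ∈ plaqsIn 0 Ω`,
`dist1 (startT3(∂q)) ≤ max (exp((2r+1)⁻²·2ε′) − 1) (81601·b)`.  Displayed: torus sizes; `dist1 V(∂Q) ≤ ε′` on `plaqsIn k Ω` (`0 ≤ ε′`); the shell bound `b` with its five smallness rows;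
the lattice binders (hbox)∕(hsep)∕(hcov) of (S5)-4b. [cite: Balaban1985Variational, (11)–(15) pp.279–280] -/
theorem dist1_plaqHol_startT3_le (hN : 2 * max (RtT (F.P K) k) ((F.P K).L ^ k / 2) + 1 ≤ (F.P K).sitesPerDir 0) (hNb : 2 * RbT (F.P K) k + 1 ≤ (F.P K).sitesPerDir 0)
    (hNk : (F.P K).sitesPerDir 0 = (F.P K).sitesPerDir k * (F.P K).L ^ k) (hRL : 2 * RbT (F.P K) k + 1 ≤ (F.P K).L ^ k)
    {ε' : ℝ} (hε0 : 0 ≤ ε') (hV : ∀ Q, Q ∈ plaqsIn k Ω → GaugeGroup.dist1 (GaugeField.plaqHol V Q) ≤ ε')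
    (hR : 1 ≤ RbT (F.P K) k) (hb : 0 ≤ b) (hsmall : 320 * (RbT (F.P K) k : ℝ) ^ 2 * b ≤ 1) (h4800 : 4800 * (RbT (F.P K) k : ℝ) * b ≤ 1)
    (hπ : (Fintype.card n : ℝ) * (200 * (RbT (F.P K) k) * b) < Real.pi) (hπ' : (Fintype.card n : ℝ) * (20 * (RbT (F.P K) k : ℝ) ^ 2 * b) < Real.pi)
    (hshell : ∀ v, IsBallΩ k Ω v → ∀ (u : Fin (F.P K).d → ℤ) (μ ν : Fin (F.P K).d), BdryPlaq (RbT (F.P K) k) u μ ν →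
      GaugeGroup.dist1 (plaqB (pullB v (tubeSecΩ k Ω V)) u μ ν) ≤ b)
    (hbox : ∀ Q, IsTubeΩ k Ω Q → ∀ q : Plaq (F.P K) 0, q ∈ plaqsIn 0 Ω → ¬ Plaq.Deep (IsBallΩ k Ω) (fun v b => BallBond v (RbT (F.P K) k) b) q →
      (∃ b, Plaq.HasBond q b ∧ TubeActive V (RtT (F.P K) k) (FpOf k V) (tfOf k Ω) (IsTubeΩ k Ω) Q b) →
      ∃ u : Fin (F.P K).d → ℤ, q.src = boxSite (cornerSite k Q.src Q.μ Q.ν) u ∧ InTube Q.μ Q.ν (RtT (F.P K) k) ((F.P K).L ^ k / 2) u ∧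
        InTube Q.μ Q.ν (RtT (F.P K) k) ((F.P K).L ^ k / 2) (u + e q.μ) ∧ InTube Q.μ Q.ν (RtT (F.P K) k) ((F.P K).L ^ k / 2) (u + e q.ν) ∧
        InTube Q.μ Q.ν (RtT (F.P K) k) ((F.P K).L ^ k / 2) (u + e q.μ + e q.ν))
    (hsep : ∀ Q Q' (q : Plaq (F.P K) 0), q ∈ plaqsIn 0 Ω → ¬ Plaq.Deep (IsBallΩ k Ω) (fun v b => BallBond v (RbT (F.P K) k) b) q →
      (∃ b, Plaq.HasBond q b ∧ TubeActive V (RtT (F.P K) k) (FpOf k V) (tfOf k Ω) (IsTubeΩ k Ω) Q b) →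
      (∃ b, Plaq.HasBond q b ∧ TubeActive V (RtT (F.P K) k) (FpOf k V) (tfOf k Ω) (IsTubeΩ k Ω) Q' b) → Q = Q')
    (hcov : ∀ q : Plaq (F.P K) 0, q ∈ plaqsIn 0 Ω → ¬ Plaq.Deep (IsBallΩ k Ω) (fun v b => BallBond v (RbT (F.P K) k) b) q → GaugeField.plaqHol (iterSec k V) q ≠ 1 →
      ∃ Q b, Plaq.HasBond q b ∧ TubeActive V (RtT (F.P K) k) (FpOf k V) (tfOf k Ω) (IsTubeΩ k Ω) Q b)
    (q : Plaq (F.P K) 0) (hq : q ∈ plaqsIn 0 Ω) :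
    GaugeGroup.dist1 (GaugeField.plaqHol (startT3 F K k Ω V b) q) ≤ max (Real.exp (((2 * (rT (F.P K) k : ℝ) + 1))⁻¹ ^ 2 * (2 * ε')) - 1) (81601 * b) := by
  unfold startT3
  exact dist1_plaqHol_startSys_le k Ω V (MballT3 F K k Ω V b) hN hNb hNk hRL (by positivity) (norm_FpOf_le_of_dist1 F K k Ω V hV) hbox hsep hcov
    (MballT3_eq_of_bdryBond hR hb hsmall h4800 hπ hπ' hshell) (dist1_plaqB_MballT3_le hR hb hsmall h4800 hπ hπ' hshell) q hq

/-- **OFF THE VERTEX CUBES AND THE ACTIVE TUBE BONDS THE START FIELD IS THE SECTION** (the (S6) line input, T³ reading). [cite: Balaban1985Variational, (11) p.279] -/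
theorem startT3_apply_of_quiet {b' : PBond (F.P K) 0} (hnb : ¬ ∃ v, IsBallΩ k Ω v ∧ BallBond v (RbT (F.P K) k) b')
    (hna : ¬ ∃ Q, TubeActive V (RtT (F.P K) k) (FpOf k V) (tfOf k Ω) (IsTubeΩ k Ω) Q b') : startT3 F K k Ω V b b' = iterSec k V b' := by
  unfold startT3
  exact startSys_apply_of_quiet k Ω V _ hnb hna

end Summit.QuantumFields.YangMills.Theorems.TubeStart

end
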